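import Summits.QuantumFields.YangMills.Theorems.UnitScaleTiltProp7SymAvgTwSymDefs
import Summits.QuantumFields.YangMills.Theorems.UnitScaleTiltProp7QSymGaugeCovariance
import Summits.QuantumFields.YangMills.Theorems.UnitScaleTiltProp7SymAvgTwEq137
import Literature.MathematicalPhysics.QuantumFieldTheory.Balaban1983to89.TorusGeometry
import HarnessLib

/-!
# Route `UnitScaleTilt`, crux K1 child «MinimiserStabilityRegPr» (stmt-QuantumFields-19200), stub EX, route (α) — **THE LEVEL SET OF THE RE-BASED CHART IS THE SYMMETRIC
# SLICE** (this seat's LOCATE 2026-08-28 ~08:20Z on OWNER RULING g26-№12): for the chart of record `logChartTwS` (✓`Prop7SymAvgTwSym`, symmetric centre-anchored frames),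
# `logChartTwS U₀ A c = log(V(c)·Ū₀(c)⁻¹)` for all comparison bonds `c` ⟺ `(frameTwS c₋)⁻¹·D̄(e^{A}U₀)(c)·frameTwS c₊ = V(c)` ⟺ **`D̄((e^{A}U₀)^{ũ}) = V` for every fine
# `GL₂(ℂ)` gauge transformation `ũ` whose values at the top-level block centres are the inverse symmetric accumulated frames** — the orbit of the chart point meets the
# (complexified) descent fibre of `V` through the SYMMETRIC transversal `ũ_S`, NOT through print's (1.29)-restricted (1.19)-axial `u` (whose top-centre values are pinned to the
# inverse COMB frames `wrec⁻¹` by print's (87): ✓`Prop7ChartSigmaT3.toUnits_descTransf_eq_wrec_inv`, whence ✓`gaugeAct_mem_fibre_iff_eq137cov` and the (T) chart's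
# ✓`Prop7SymAvgTwEq137.logChartTw_eq_mlog_iff_eq137cov`).

Cell `ym3-torus` ∕ width seat `ym-ust-20520-w5` (gen 3).  YM₃ on T³ is ladder rung R3, not the Clay problem; nothing here is a claim about the stub, the crux or the gap.

THE PRINT.  [Balaban1985RegularSpaces] p. 81: «The configurations U′ satisfy the equations Ũ′ʲ = V(Ū₀ʲ)⁻¹ on Λ_j, hence U₁ satisfies (Ũ₁^{u j})_b = u(b₋)(Ũ₁ʲ)_bu⁻¹(b₊) =
V_b(Ū₀ʲ)_b⁻¹ (1.30)», with «u(y) = (\overline{R_{0,y}U₁}^{(k)})⁻¹ on Ω^{(k)} (87)» [Balaban1985Averaging] p. 31 — the gauge transformation's CENTRE values are the inverse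
accumulated block frames; fibre membership of `(U₁U₀)^u` reads only those centre values ([Balaban1985Averaging] (11) p. 19: `\overline{V^u} = (V̄)^{u∘centres}`).

WHAT IS PROVED (pure algebra over the defs of ✓p615607 and the exact `GL` covariance ✓`Prop7QSymGaugeCovariance.descendToGL_gaugeActT`; def-free; no estimate):
§1 `dbarTwS_eq_mul_inv_iff` — `U̿^{twS}(A)(c) = X·Ū₀(c)⁻¹ ⟺ D̄(e^{A}U₀)(c) = w(c₋)·X·w(c₊)⁻¹` (group algebra, ✓`inv_mul_mul_mul_inv_eq_iff`); §2 ★`descendToGL_gaugeActT_apply_eq_iff`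
∕ ★★`descendToGL_gaugeActT_eq_iff` — for every fine `ũ` with `transfUp ũ (K−n) ŷ = (frameTwS U₀ A y)⁻¹`: `D̄((e^{A}U₀♭)^{ũ}) = V♭ ⟺ ∀ c, U̿^{twS}(A)(c) = V♭(c)·Ū₀(c)⁻¹`;
§3 the `log` forms inside the two windows (`eq_of_mlog_eq`): ★★★`descendToGL_gaugeActT_eq_of_logChartTwS_eq_mlog` and its converse `logChartTwS_eq_mlog_of_descendToGL_gaugeActT_eq`;
§4 `embIter_injective`, ★`exists_transfUp_eq` — such `ũ` exist for ANY prescribed centre data (so the level set lies in the union of fine `GL`-orbits through the `GL`-fibre of `V`).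
HONEST SCOPE.  `GL₂(ℂ)` letters throughout (`descendToGL`, `bgUnits`, units fields); the `SU(2)` ∕ `fibre F ℰp` upgrade (unitarity of the frames on unitary data, ✓`eml_mem_specialUnitaryGroup`;
`descendToGL = D` on regular fields, ✓`unitsField_toUField_descendTo_of_regPr`) is NOT here.  This file does NOT deliver print's (20) `Prop7SPrint.AvgCondPrint` (restricted-axial
witness) from the S chart — by the cited (87) that junction belongs to the COMB-framed (T) chart; which slice the EX knit carries is an OWNER∕knit-ruler decision (bus 08:20Z, options (α-S)∕(α-T)).
`--supports stmt-QuantumFields-19200 --as helper`.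

References: T. Bałaban, CMP 99 (1985) 75–102 [Balaban1985RegularSpaces] ((1.28)–(1.31) pp.81–82, (1.37) p.82); CMP 98 (1985) 17–51 [Balaban1985Averaging] ((11) p.19, (85)–(89) p.31,
(92) p.31, (97) p.32); CMP 109 (1987) 249–301 [Balaban1987RG1] ((0.1)–(0.4) pp.251–253).
-/

noncomputable section

open scoped Matrix.Norms.L2Operator

namespace Summit.QuantumFields.YangMills.Theorems.Prop7SymAvgTwSymSlice

open NormedSpace
open Literature.MathematicalPhysics.QuantumFieldTheory.Balaban1983to89
open Literature.MathematicalPhysics.QuantumFieldTheory.Balaban1983to89.T3ContinuumYM3Torus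
open T4Continuum (transfUp)
open B15DeterminingSets (embIter)
open T3LevelShift (siteShift)
open T3PrintedRegularOrbits (sites_eq)
open T3SectALandauChart (bgUnits)
open B7Prop1Explicit (expUnit)
open B10Eq27TorusAxialLog (gaugeActT)
open MatrixLog (mlog)
open Summit.QuantumFields.YangMills.Theorems.Prop7SymAvgGL (descendToGL)
open Summit.QuantumFields.YangMills.Theorems.Prop7SymAvgTwSym (frameTwS dbarTwS logChartTwS dbarTwS_def logChartTwS_apply)
open Summit.QuantumFields.YangMills.Theorems.Prop7QSymGaugeCovariance (descendToGL_gaugeActT)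
open Summit.QuantumFields.YangMills.Theorems.Prop7SymAvgTwEq137 (inv_mul_mul_mul_inv_eq_iff eq_of_mlog_eq)

variable (F : T3Family) {n K : ℕ} (h : n ≤ K)

/-! ## §1 Group algebra: the double-bar value against a datum -/

/-- **`U̿^{twS}(A)(c) = X·Ū₀(c)⁻¹ ⟺ D̄(e^{A}U₀)(c) = w(c₋)·X·w(c₊)⁻¹`** (print's (1.30)∕(1.31) rearranged; `w = frameTwS U₀ A`).
[cite: Balaban1985RegularSpaces, (1.30)–(1.31) pp.81–82; Balaban1985Averaging, (89)–(92) p.31] -/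
theorem dbarTwS_eq_mul_inv_iff (U₀ : GaugeField (F.P K) 0 (Matrix.specialUnitaryGroup (Fin 2) ℂ)) (A : PBond (F.P K) 0 → Matrix (Fin 2) (Fin 2) ℂ)
    (c : PBond (F.P n) 0) (X : (Matrix (Fin 2) (Fin 2) ℂ)ˣ) :
    dbarTwS F n K h U₀ A c = X * (descendToGL F n K h (bgUnits F K U₀) c)⁻¹ ↔
      descendToGL F n K h (fun b => expUnit (A b) * bgUnits F K U₀ b) c = frameTwS F n K h U₀ A c.src * X * (frameTwS F n K h U₀ A c.tgt)⁻¹ := by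
  rw [dbarTwS_def]
  exact inv_mul_mul_mul_inv_eq_iff _ _ _ _ _

/-! ## §2 The symmetric transversal: fine gauge transformations with the inverse symmetric frames at the top centres -/

/-- ★ **AT ONE BOND**: for a fine `GL` gauge transformation `ũ` whose values at the top-level block centres `x̂_y` are the inverse symmetric accumulated frames,
`D̄((e^{A}U₀♭)^{ũ})(c) = X ⟺ U̿^{twS}(A)(c) = X·Ū₀(c)⁻¹` — exact `GL` covariance of the symmetric descent ([Balaban1985Averaging] (11)) plus §1.
[cite: Balaban1985Averaging, (11) p.19, (87) p.31; Balaban1985RegularSpaces, (1.30) p.81] -/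
theorem descendToGL_gaugeActT_apply_eq_iff (U₀ : GaugeField (F.P K) 0 (Matrix.specialUnitaryGroup (Fin 2) ℂ)) (A : PBond (F.P K) 0 → Matrix (Fin 2) (Fin 2) ℂ)
    (ũ : GaugeTransf (F.P K) 0 (Matrix (Fin 2) (Fin 2) ℂ)ˣ) (hũ : ∀ y : Site (F.P n) 0, transfUp ũ (K - n) (siteShift (sites_eq F n K h) y) = (frameTwS F n K h U₀ A y)⁻¹)
    (c : PBond (F.P n) 0) (X : (Matrix (Fin 2) (Fin 2) ℂ)ˣ) :
    descendToGL F n K h (gaugeActT ũ (fun b => expUnit (A b) * bgUnits F K U₀ b)) c = X ↔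
      dbarTwS F n K h U₀ A c = X * (descendToGL F n K h (bgUnits F K U₀) c)⁻¹ := by
  rw [descendToGL_gaugeActT, hũ, hũ, inv_inv, dbarTwS_eq_mul_inv_iff]
  constructor
  · intro h1
    rw [← h1]
    group
  · intro h1
    rw [h1]
    group

/-- ★★ **THE LEVEL SET OF THE RE-BASED CHART IS THE SYMMETRIC SLICE (group form)**: `D̄((e^{A}U₀♭)^{ũ}) = V♭ ⟺ ∀ c, U̿^{twS}(A)(c) = V♭(c)·Ū₀(c)⁻¹`, for every fine `ũ` with the
inverse symmetric frames at the top centres. [cite: Balaban1985Averaging, (11) p.19, (87)–(92) p.31; Balaban1985RegularSpaces, (1.28)–(1.31) pp.81–82] -/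
theorem descendToGL_gaugeActT_eq_iff (U₀ : GaugeField (F.P K) 0 (Matrix.specialUnitaryGroup (Fin 2) ℂ)) (A : PBond (F.P K) 0 → Matrix (Fin 2) (Fin 2) ℂ)
    (ũ : GaugeTransf (F.P K) 0 (Matrix (Fin 2) (Fin 2) ℂ)ˣ) (hũ : ∀ y : Site (F.P n) 0, transfUp ũ (K - n) (siteShift (sites_eq F n K h) y) = (frameTwS F n K h U₀ A y)⁻¹)
    (Vf : GaugeField (F.P n) 0 (Matrix (Fin 2) (Fin 2) ℂ)ˣ) :
    descendToGL F n K h (gaugeActT ũ (fun b => expUnit (A b) * bgUnits F K U₀ b)) = Vf ↔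
      ∀ c : PBond (F.P n) 0, dbarTwS F n K h U₀ A c = Vf c * (descendToGL F n K h (bgUnits F K U₀) c)⁻¹ := by
  constructor
  · intro hV c
    exact (descendToGL_gaugeActT_apply_eq_iff F h U₀ A ũ hũ c (Vf c)).1 (congrFun hV c)
  · intro hc
    funext c
    exact (descendToGL_gaugeActT_apply_eq_iff F h U₀ A ũ hũ c (Vf c)).2 (hc c)

/-! ## §3 Logarithmic form inside the two windows -/

/-- Inside the windows `‖U̿^{twS}(A)(c) − 1‖ < 1`, `‖V♭(c)Ū₀(c)⁻¹ − 1‖ < 1` the log equation is the group equation (`log` injective there).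
[cite: Balaban1985RegularSpaces, (1.31) p.82, (1.37) p.82] -/
theorem dbarTwS_eq_of_logChartTwS_eq_mlog (U₀ : GaugeField (F.P K) 0 (Matrix.specialUnitaryGroup (Fin 2) ℂ)) (A : PBond (F.P K) 0 → Matrix (Fin 2) (Fin 2) ℂ)
    (Vf : GaugeField (F.P n) 0 (Matrix (Fin 2) (Fin 2) ℂ)ˣ) (c : PBond (F.P n) 0)
    (hwin : ‖((dbarTwS F n K h U₀ A c : (Matrix (Fin 2) (Fin 2) ℂ)ˣ) : Matrix (Fin 2) (Fin 2) ℂ) - 1‖ < 1)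
    (hwinV : ‖((Vf c * (descendToGL F n K h (bgUnits F K U₀) c)⁻¹ : (Matrix (Fin 2) (Fin 2) ℂ)ˣ) : Matrix (Fin 2) (Fin 2) ℂ) - 1‖ < 1)
    (hlog : logChartTwS F n K h U₀ A c = mlog ((Vf c * (descendToGL F n K h (bgUnits F K U₀) c)⁻¹ : (Matrix (Fin 2) (Fin 2) ℂ)ˣ) : Matrix (Fin 2) (Fin 2) ℂ)) :
    dbarTwS F n K h U₀ A c = Vf c * (descendToGL F n K h (bgUnits F K U₀) c)⁻¹ := by
  rw [logChartTwS_apply] at hlog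
  exact Units.ext (eq_of_mlog_eq hwin hwinV hlog)

/-- Conversely the group equation gives the log equation (no window needed). [cite: Balaban1985RegularSpaces, (1.31) p.82] -/
theorem logChartTwS_eq_mlog_of_dbarTwS_eq (U₀ : GaugeField (F.P K) 0 (Matrix.specialUnitaryGroup (Fin 2) ℂ)) (A : PBond (F.P K) 0 → Matrix (Fin 2) (Fin 2) ℂ)
    (Vf : GaugeField (F.P n) 0 (Matrix (Fin 2) (Fin 2) ℂ)ˣ) (c : PBond (F.P n) 0)
    (hc : dbarTwS F n K h U₀ A c = Vf c * (descendToGL F n K h (bgUnits F K U₀) c)⁻¹) :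
    logChartTwS F n K h U₀ A c = mlog ((Vf c * (descendToGL F n K h (bgUnits F K U₀) c)⁻¹ : (Matrix (Fin 2) (Fin 2) ℂ)ˣ) : Matrix (Fin 2) (Fin 2) ℂ) := by
  rw [logChartTwS_apply, hc]

/-- ★★★ **THE LOG CHART'S DATUM EQUATION PUTS THE CHART POINT ON THE SYMMETRIC SLICE**: if `logChartTwS U₀ A c = log(V♭(c)Ū₀(c)⁻¹)` for all `c` (inside the two windows), then
`D̄((e^{A}U₀♭)^{ũ}) = V♭` for EVERY fine `GL` gauge transformation `ũ` with the inverse symmetric accumulated frames at the top centres.  (Contrast: print's (20) asks for a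
(1.29)-restricted, (1.19)-axial `u`, whose centre values are `wrec⁻¹` — the COMB frames — by (87); that junction is the (T) chart's ✓`logChartTw_eq_mlog_iff_eq137cov`, not this one.)
[cite: Balaban1985RegularSpaces, (1.28)–(1.31) pp.81–82, (1.37) p.82; Balaban1985Averaging, (11) p.19, (87) p.31] -/
theorem descendToGL_gaugeActT_eq_of_logChartTwS_eq_mlog (U₀ : GaugeField (F.P K) 0 (Matrix.specialUnitaryGroup (Fin 2) ℂ)) (A : PBond (F.P K) 0 → Matrix (Fin 2) (Fin 2) ℂ)
    (Vf : GaugeField (F.P n) 0 (Matrix (Fin 2) (Fin 2) ℂ)ˣ)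
    (hwin : ∀ c : PBond (F.P n) 0, ‖((dbarTwS F n K h U₀ A c : (Matrix (Fin 2) (Fin 2) ℂ)ˣ) : Matrix (Fin 2) (Fin 2) ℂ) - 1‖ < 1)
    (hwinV : ∀ c : PBond (F.P n) 0, ‖((Vf c * (descendToGL F n K h (bgUnits F K U₀) c)⁻¹ : (Matrix (Fin 2) (Fin 2) ℂ)ˣ) : Matrix (Fin 2) (Fin 2) ℂ) - 1‖ < 1)
    (hlog : ∀ c : PBond (F.P n) 0,
      logChartTwS F n K h U₀ A c = mlog ((Vf c * (descendToGL F n K h (bgUnits F K U₀) c)⁻¹ : (Matrix (Fin 2) (Fin 2) ℂ)ˣ) : Matrix (Fin 2) (Fin 2) ℂ))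
    (ũ : GaugeTransf (F.P K) 0 (Matrix (Fin 2) (Fin 2) ℂ)ˣ) (hũ : ∀ y : Site (F.P n) 0, transfUp ũ (K - n) (siteShift (sites_eq F n K h) y) = (frameTwS F n K h U₀ A y)⁻¹) :
    descendToGL F n K h (gaugeActT ũ (fun b => expUnit (A b) * bgUnits F K U₀ b)) = Vf :=
  (descendToGL_gaugeActT_eq_iff F h U₀ A ũ hũ Vf).2 fun c => dbarTwS_eq_of_logChartTwS_eq_mlog F h U₀ A Vf c (hwin c) (hwinV c) (hlog c)

/-- … and conversely: on the symmetric slice the log chart takes the datum value. [cite: Balaban1985RegularSpaces, (1.30)–(1.31) pp.81–82] -/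
theorem logChartTwS_eq_mlog_of_descendToGL_gaugeActT_eq (U₀ : GaugeField (F.P K) 0 (Matrix.specialUnitaryGroup (Fin 2) ℂ)) (A : PBond (F.P K) 0 → Matrix (Fin 2) (Fin 2) ℂ)
    (Vf : GaugeField (F.P n) 0 (Matrix (Fin 2) (Fin 2) ℂ)ˣ)
    (ũ : GaugeTransf (F.P K) 0 (Matrix (Fin 2) (Fin 2) ℂ)ˣ) (hũ : ∀ y : Site (F.P n) 0, transfUp ũ (K - n) (siteShift (sites_eq F n K h) y) = (frameTwS F n K h U₀ A y)⁻¹)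
    (hV : descendToGL F n K h (gaugeActT ũ (fun b => expUnit (A b) * bgUnits F K U₀ b)) = Vf) (c : PBond (F.P n) 0) :
    logChartTwS F n K h U₀ A c = mlog ((Vf c * (descendToGL F n K h (bgUnits F K U₀) c)⁻¹ : (Matrix (Fin 2) (Fin 2) ℂ)ˣ) : Matrix (Fin 2) (Fin 2) ℂ) :=
  logChartTwS_eq_mlog_of_dbarTwS_eq F h U₀ A Vf c ((descendToGL_gaugeActT_eq_iff F h U₀ A ũ hũ Vf).1 hV c)

/-! ## §4 Such gauge transformations exist for any centre data -/

/-- `embIter j` is injective in the standing range (`blockOf ∘ emb = id` level by level). [cite: Balaban1987RG1, (0.1)–(0.3) pp.251–252] -/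
theorem embIter_injective {P : Params} : ∀ j : ℕ, j ≤ P.m + P.K → Function.Injective (embIter (P := P) j)
  | 0, _ => fun a b hab => hab
  | j + 1, hj => fun a b hab => by
    have h1 : emb a = emb b := embIter_injective j (by omega) hab
    have h2 := congrArg blockOf h1
    rwa [Site.blockOf_emb hj, Site.blockOf_emb hj] at h2

/-- `transfUp ũ j y = ũ (x̂_y)` — the descended gauge transformation reads the fine one at the iterated centre. [cite: Balaban1985Averaging, (11) p.19] -/
theorem transfUp_eq_embIter {P : Params} {G : Type*} [Group G] (u : GaugeTransf P 0 G) : ∀ (j : ℕ) (y : Site P j), transfUp u j y = u (embIter j y)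
  | 0, _ => rfl
  | j + 1, y => transfUp_eq_embIter u j (emb y)

/-- ★ **EXISTENCE OF THE SYMMETRIC TRANSVERSAL'S GAUGE MAPS**: for ANY prescribed centre data `g : T^{(n)}_0 → GL₂(ℂ)` there is a fine gauge transformation `ũ` on `T^{(K)}_0` with
`transfUp ũ (K − n) ŷ = g y` at every comparison site (extend by `1` off the top centres; the centres are distinct by `embIter_injective`).  In particular the hypothesis `hũ` of §2–§3 is
inhabited with `g := (frameTwS U₀ A ·)⁻¹`. [cite: Balaban1985Averaging, (87) p.31; Balaban1987RG1, (0.1) p.251] -/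
theorem exists_transfUp_eq (g : Site (F.P n) 0 → (Matrix (Fin 2) (Fin 2) ℂ)ˣ) :
    ∃ ũ : GaugeTransf (F.P K) 0 (Matrix (Fin 2) (Fin 2) ℂ)ˣ, ∀ y : Site (F.P n) 0, transfUp ũ (K - n) (siteShift (sites_eq F n K h) y) = g y := by
  have hKn : K - n ≤ (F.P K).m + (F.P K).K := by
    show K - n ≤ F.m + K
    omega
  have hinj : Function.Injective fun y : Site (F.P n) 0 => embIter (K - n) (siteShift (sites_eq F n K h) y) :=
    fun a b hab => (siteShift (sites_eq F n K h)).injective (embIter_injective (K - n) hKn hab)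
  refine ⟨Function.extend (fun y : Site (F.P n) 0 => embIter (K - n) (siteShift (sites_eq F n K h) y)) g (fun _ => 1), fun y => ?_⟩
  rw [transfUp_eq_embIter]
  exact hinj.extend_apply g (fun _ => 1) y

/-- ★★ **COROLLARY — THE CHART POINT'S ORBIT MEETS THE `GL`-FIBRE**: the datum equation of the re-based chart (inside the windows) gives a fine `GL` gauge transformation `ũ` with
`D̄((e^{A}U₀♭)^{ũ}) = V♭`. [cite: Balaban1985RegularSpaces, (1.28)–(1.31) pp.81–82; Balaban1985Averaging, (87) p.31] -/
theorem exists_gaugeActT_descendToGL_eq_of_logChartTwS_eq_mlog (U₀ : GaugeField (F.P K) 0 (Matrix.specialUnitaryGroup (Fin 2) ℂ))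
    (A : PBond (F.P K) 0 → Matrix (Fin 2) (Fin 2) ℂ) (Vf : GaugeField (F.P n) 0 (Matrix (Fin 2) (Fin 2) ℂ)ˣ)
    (hwin : ∀ c : PBond (F.P n) 0, ‖((dbarTwS F n K h U₀ A c : (Matrix (Fin 2) (Fin 2) ℂ)ˣ) : Matrix (Fin 2) (Fin 2) ℂ) - 1‖ < 1)
    (hwinV : ∀ c : PBond (F.P n) 0, ‖((Vf c * (descendToGL F n K h (bgUnits F K U₀) c)⁻¹ : (Matrix (Fin 2) (Fin 2) ℂ)ˣ) : Matrix (Fin 2) (Fin 2) ℂ) - 1‖ < 1)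
    (hlog : ∀ c : PBond (F.P n) 0,
      logChartTwS F n K h U₀ A c = mlog ((Vf c * (descendToGL F n K h (bgUnits F K U₀) c)⁻¹ : (Matrix (Fin 2) (Fin 2) ℂ)ˣ) : Matrix (Fin 2) (Fin 2) ℂ)) :
    ∃ ũ : GaugeTransf (F.P K) 0 (Matrix (Fin 2) (Fin 2) ℂ)ˣ,
      (∀ y : Site (F.P n) 0, transfUp ũ (K - n) (siteShift (sites_eq F n K h) y) = (frameTwS F n K h U₀ A y)⁻¹) ∧
        descendToGL F n K h (gaugeActT ũ (fun b => expUnit (A b) * bgUnits F K U₀ b)) = Vf := by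
  obtain ⟨ũ, hũ⟩ := exists_transfUp_eq F h fun y => (frameTwS F n K h U₀ A y)⁻¹
  exact ⟨ũ, hũ, descendToGL_gaugeActT_eq_of_logChartTwS_eq_mlog F h U₀ A Vf hwin hwinV hlog ũ hũ⟩

end Summit.QuantumFields.YangMills.Theorems.Prop7SymAvgTwSymSlice

end
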